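import Mathlib
import Summits.Ventures.HodgeRepro2.T6A1Dict
import Summits.Ventures.HodgeRepro2.T6A3BaseChange

/-!
# T6A1DictRat — the identification `φ₁ : H¹(B, ℂ)_model ≃ H¹_host` from a rational structure

Tier-6 sub-goal A1, Layer III (README §10; TARGET-T6.md §2 Layer III; owner t6-p1, gen 2; STATUS
l. 5135 (3)). `T6A1Dict.H1Ident` asks for a `K`-equivariant `ℂ`-linear isomorphism `φ₁ : Fin 4 → K ⊗ ℂ ≃ V1`
of the model's `H¹(B, ℂ)` with a host-shaped carrier `V1` carrying a field action `act : K →+* End(V1)`.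
This file BUILDS it from what the host will supply: a RATIONAL STRUCTURE `R ⊆ V1` (a `ℚ`-subspace — the
rational classes `H¹(B(ℂ), ℚ) ⊆ H¹(B(ℂ), ℂ)`, Lange–Birkenhake Lemma 1.1.17 «`H¹(X, ℤ) = Hom(Λ, ℤ)`» with
the universal coefficient theorem «`H¹(X, ℚ) ⊗ ℂ = H¹(X, ℂ)`», i.e. `ℂ ⊗[ℚ] R ≃ V1` through `c ⊗ r ↦ c • r`)
which is STABLE under the action (`act x` is a rational combination of pull-backs along endomorphisms,
which preserve rational classes), together with the dimension count `dim_ℂ V1 = 24 = 2 · dim B` (Lemma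
1.1.17 for `B = A₁ × ⋯ × A₄`) and `[K : ℚ] = 6`. Mathematics (TIER4 A0.3: «`H¹(B, ℚ)` is a free `K`-module
of rank 4»): `R` is a `K`-vector space through `act` (`RatStructure.actRHom`, `instModuleK`), of `K`-dimension
`24 / 6 = 4` (the tower law `Module.finrank_mul_finrank`), hence `K`-isomorphic to `Fin 4 → K = H1 K`
(`LinearEquiv.ofFinrankEq`, `psi`); base change to `ℂ` and the rational-structure isomorphism give
`φ₁ := h1Equiv⁻¹ ≫ (ℂ ⊗ ψ) ≫ (ℂ ⊗[ℚ] R ≃ V1)`, which intertwines `actH1C K x` with `act x` (`phi_act`) and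
carries the model's rational classes `h1ToC (H1 K)` onto `R` (`phi_h1ToC_mem`, `exists_phi_h1ToC_eq`).
`hrat_of` turns the host-level rationality clause of degree 4 («every rational class of `H⁴` is a
`ℚ`-combination of four-fold cup products of rational classes of `H¹`», Lange Ex. 1.1.6(7) over `ℤ` + UCT)
into the clause `T6A1Dict.ofLange` consumes, and `identOfRat` packages everything into an `H1Ident`: the
host composite of M0 → M1 then needs, per corner product, only the host `TransferShadow` and the
`D.Alg 2 ↦ algebraicClasses` clause. §8(d): uses an L-value-free non-vanishing device: NO.
-/

namespace Summit.Ventures.HodgeRepro2.T6.A1DictRat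

open scoped TensorProduct
open A1Dict A2Model A3BaseChange

section carrier

variable {V1 : Type*} [AddCommGroup V1] [Module ℂ V1] [Module ℚ V1] [IsScalarTower ℚ ℂ V1]

/-- `c ↦ (r ↦ c • r)`, `ℂ`-linear in `c`. -/
noncomputable def smulR (R : Submodule ℚ V1) : ℂ →ₗ[ℂ] (R →ₗ[ℚ] V1) where
  toFun c := c • (R.subtype : R →ₗ[ℚ] V1)
  map_add' c d := add_smul c d _
  map_smul' c d := by simp only [smul_eq_mul, RingHom.id_apply, mul_smul]

/-- The rational-structure map `ℂ ⊗[ℚ] R → V1`, `c ⊗ r ↦ c • r` (`ℂ`-linear). -/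
noncomputable def toV (R : Submodule ℚ V1) : ℂ ⊗[ℚ] R →ₗ[ℂ] V1 :=
  TensorProduct.AlgebraTensorModule.lift (smulR R)

/-- `toV (c ⊗ r) = c • r`. -/
@[simp] theorem toV_tmul (R : Submodule ℚ V1) (c : ℂ) (r : R) : toV R (c ⊗ₜ[ℚ] r) = c • (r : V1) := by
  simp [toV, smulR]

end carrier

section structure_def

variable {K : Type*} [Field K] [NumberField K]
variable {V1 : Type*} [AddCommGroup V1] [Module ℂ V1] [Module ℚ V1] [IsScalarTower ℚ ℂ V1]

/-- A RATIONAL STRUCTURE on the host-shaped carrier `V1`, stable under the field action `act`: a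
`ℚ`-subspace `R` (the rational classes of `H¹`), closed under every `act x`, with `ℂ ⊗[ℚ] R ≃ V1` through
`c ⊗ r ↦ c • r` (the universal coefficient theorem in the host's words). -/
structure RatStructure (act : K →+* Module.End ℂ V1) where
  /-- the rational classes -/
  R : Submodule ℚ V1
  /-- the action preserves rational classes -/
  act_mem : ∀ (x : K), ∀ r ∈ R, act x r ∈ R
  /-- `ℂ ⊗[ℚ] R ≃ V1` -/
  toV_bijective : Function.Bijective (toV R)

namespace RatStructure

variable {act : K →+* Module.End ℂ V1} (S : RatStructure act)

/-- `act x` restricted to the rational classes, as a `ℚ`-endomorphism of `R`. -/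
noncomputable def actR (x : K) : Module.End ℚ S.R :=
  ((act x).restrictScalars ℚ).restrict fun r hr => S.act_mem x r hr

omit [NumberField K] in
/-- `actR` is `act` on the coordinates. -/
@[simp] theorem coe_actR (x : K) (r : S.R) : (S.actR x r : V1) = act x r := rfl

/-- The action of `K` on the rational classes, as a ring homomorphism `K →+* End_ℚ(R)`. -/
noncomputable def actRHom : K →+* Module.End ℚ S.R where
  toFun := S.actR
  map_one' := by
    ext r
    simp only [coe_actR, map_one, Module.End.one_apply]
  map_mul' x y := by
    ext r
    simp only [coe_actR, map_mul, Module.End.mul_apply]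
  map_zero' := by
    ext r
    simp only [coe_actR, map_zero, LinearMap.zero_apply, Submodule.coe_zero]
  map_add' x y := by
    ext r
    simp only [coe_actR, map_add, LinearMap.add_apply, Submodule.coe_add]

/-- The rational classes as a `K`-vector space through `act` (TIER4 A0.3). -/
noncomputable instance instModuleK : Module K S.R := Module.compHom S.R S.actRHom

omit [NumberField K] in
/-- The `K`-action on the rational classes, in `V1`. -/
@[simp] theorem coe_smul (x : K) (r : S.R) : ((x • r : S.R) : V1) = act x r := rfl

/-- The `ℚ`-structure and the `K`-structure of `R` are compatible. -/
instance instIsScalarTower : IsScalarTower ℚ K S.R :=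
  ⟨fun q x r => Subtype.ext (by
    show act (q • x) r = q • (act x r : V1)
    rw [Algebra.smul_def, map_mul, Module.End.mul_apply, RingHom.map_rat_algebraMap,
      Module.algebraMap_end_apply])⟩

/-- The rational-structure isomorphism `ℂ ⊗[ℚ] R ≃ₗ[ℂ] V1`. -/
noncomputable def toVEquiv : ℂ ⊗[ℚ] S.R ≃ₗ[ℂ] V1 := LinearEquiv.ofBijective (toV S.R) S.toV_bijective

omit [NumberField K] in
/-- `toVEquiv (c ⊗ r) = c • r`. -/
@[simp] theorem toVEquiv_tmul (c : ℂ) (r : S.R) : S.toVEquiv (c ⊗ₜ[ℚ] r) = c • (r : V1) := toV_tmul _ c r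

omit [NumberField K] in
/-- `dim_ℚ R = dim_ℂ V1` (base change). -/
theorem finrank_R : Module.finrank ℚ S.R = Module.finrank ℂ V1 := by
  rw [← S.toVEquiv.finrank_eq, Module.finrank_baseChange]

/-- `dim_K R = 4` when `dim_ℂ V1 = 24` and `[K : ℚ] = 6` (the tower law). -/
theorem finrank_K (hV : Module.finrank ℂ V1 = 24) (hdeg : Module.finrank ℚ K = 6) :
    Module.finrank K S.R = 4 := by
  have h := Module.finrank_mul_finrank ℚ K S.R
  rw [S.finrank_R, hV, hdeg] at h
  omega

/-- `R` is finite-dimensional over `K` (from the dimension count). -/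
theorem finite_K (hV : Module.finrank ℂ V1 = 24) (hdeg : Module.finrank ℚ K = 6) :
    Module.Finite K S.R :=
  Module.finite_of_finrank_pos (by rw [S.finrank_K hV hdeg]; norm_num)

/-- THE `K`-LINEAR IDENTIFICATION `H1 K = Fin 4 → K ≃ R` (TIER4 A0.3: `H¹(B, ℚ)` is free of rank 4
over `K`). -/
noncomputable def psi (hV : Module.finrank ℂ V1 = 24) (hdeg : Module.finrank ℚ K = 6) :
    H1 K ≃ₗ[K] S.R :=
  haveI := S.finite_K hV hdeg
  LinearEquiv.ofFinrankEq (H1 K) S.R (by rw [Module.finrank_fin_fun, S.finrank_K hV hdeg])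

/-- `psi` is `ℚ`-linear. -/
noncomputable def psiQ (hV : Module.finrank ℂ V1 = 24) (hdeg : Module.finrank ℚ K = 6) :
    H1 K ≃ₗ[ℚ] S.R :=
  (S.psi hV hdeg).restrictScalars ℚ

/-- `psiQ` is `psi`. -/
@[simp] theorem psiQ_apply (hV : Module.finrank ℂ V1 = 24) (hdeg : Module.finrank ℚ K = 6) (w : H1 K) :
    S.psiQ hV hdeg w = S.psi hV hdeg w := rfl

/-- THE IDENTIFICATION `φ₁ : H¹(B, ℂ)_model ≃ₗ[ℂ] V1`: `h1Equiv⁻¹`, then `ℂ ⊗ psi`, then the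
rational-structure isomorphism. -/
noncomputable def phi (hV : Module.finrank ℂ V1 = 24) (hdeg : Module.finrank ℚ K = 6) :
    H1C K ≃ₗ[ℂ] V1 :=
  (h1Equiv K).symm.trans (((S.psiQ hV hdeg).baseChange ℚ ℂ (H1 K) S.R).trans S.toVEquiv)

/-- `φ₁` on a pure tensor `(i ↦ c ⊗ w i)`: `c • psi w`. -/
theorem phi_h1Equiv_tmul (hV : Module.finrank ℂ V1 = 24) (hdeg : Module.finrank ℚ K = 6) (c : ℂ)
    (w : H1 K) : S.phi hV hdeg (h1Equiv K (c ⊗ₜ[ℚ] w)) = c • (S.psi hV hdeg w : V1) := by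
  simp [phi]

/-- `φ₁` on a rational model class: `psi`. -/
theorem phi_h1ToC (hV : Module.finrank ℂ V1 = 24) (hdeg : Module.finrank ℚ K = 6) (w : H1 K) :
    S.phi hV hdeg (h1ToC K w) = (S.psi hV hdeg w : V1) := by
  have h : h1ToC K w = h1Equiv K ((1 : ℂ) ⊗ₜ[ℚ] w) := by
    rw [h1Equiv_tmul]
    funext i
    rfl
  rw [h, phi_h1Equiv_tmul, one_smul]

/-- `actH1C` on a pure tensor: `x` acts on the rational factor. -/
theorem actH1C_h1Equiv_tmul (x : K) (c : ℂ) (w : H1 K) :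
    actH1C K x (h1Equiv K (c ⊗ₜ[ℚ] w)) = h1Equiv K (c ⊗ₜ[ℚ] (x • w)) := by
  rw [h1Equiv_tmul, h1Equiv_tmul]
  funext i
  rw [actH1C_apply, Pi.smul_apply, smul_eq_mul, Algebra.TensorProduct.includeRight_apply,
    Algebra.TensorProduct.tmul_mul_tmul, one_mul]

/-- `φ₁` IS `K`-EQUIVARIANT: `φ₁ ([x]^*_ℂ v) = act x (φ₁ v)` (the field of `T6A1Dict.H1Ident`). -/
theorem phi_act (hV : Module.finrank ℂ V1 = 24) (hdeg : Module.finrank ℚ K = 6) (x : K) (v : H1C K) :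
    S.phi hV hdeg (actH1C K x v) = act x (S.phi hV hdeg v) := by
  obtain ⟨w, rfl⟩ := (h1Equiv K).surjective v
  induction w using TensorProduct.induction_on with
  | zero => simp
  | tmul c u =>
    rw [actH1C_h1Equiv_tmul, phi_h1Equiv_tmul, phi_h1Equiv_tmul, (S.psi hV hdeg).map_smul, coe_smul,
      (act x).map_smul]
  | add a b ha hb => simp only [map_add, ha, hb]

/-- `φ₁` carries the model's rational classes into `R`. -/
theorem phi_h1ToC_mem (hV : Module.finrank ℂ V1 = 24) (hdeg : Module.finrank ℚ K = 6) (w : H1 K) :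
    S.phi hV hdeg (h1ToC K w) ∈ S.R := by
  rw [phi_h1ToC]
  exact Subtype.mem _

/-- Every rational class of the host is `φ₁` of a model rational class. -/
theorem exists_phi_h1ToC_eq (hV : Module.finrank ℂ V1 = 24) (hdeg : Module.finrank ℚ K = 6) {r : V1}
    (hr : r ∈ S.R) : ∃ w : H1 K, S.phi hV hdeg (h1ToC K w) = r :=
  ⟨(S.psi hV hdeg).symm ⟨r, hr⟩, by rw [phi_h1ToC, LinearEquiv.apply_symm_apply]⟩

end RatStructure

end structure_def

/-! ## The `H1Ident` from a rational structure and Lange's isomorphism -/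

section ident

variable {K : Type*} [Field K] [NumberField K]
variable {V1 V4 : Type*} [AddCommGroup V1] [Module ℂ V1] [Module ℚ V1] [IsScalarTower ℚ ℂ V1]
  [AddCommGroup V4] [Module ℂ V4]
variable {act : K →+* Module.End ℂ V1} {cup4 : V1 → V1 → V1 → V1 → V4} {ratl4 : V4 → Prop}

/-- The host-level rationality clause of degree 4 — «every rational class of `H⁴` is a `ℚ`-combination
of four-fold cup products of rational classes of `H¹`» (Lange–Birkenhake Ex. 1.1.6(7) over `ℤ` + UCT) —
gives the clause of `T6A1Dict.ofLange`. -/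
theorem hrat_of (S : RatStructure act) (hV : Module.finrank ℂ V1 = 24)
    (hdeg : Module.finrank ℚ K = 6)
    (hrat4 : ∀ c : V4, ratl4 c → ∃ (n : ℕ) (q : Fin n → ℚ) (r : Fin n → Fin 4 → V1),
      (∀ i j, r i j ∈ S.R) ∧ c = ∑ i, (q i : ℂ) • cup4 (r i 0) (r i 1) (r i 2) (r i 3)) :
    ∀ c : V4, ratl4 c → ∃ (n : ℕ) (q : Fin n → ℚ) (w : Fin n → Fin 4 → H1 K),
      c = ∑ i, (q i : ℂ) • cup4 (S.phi hV hdeg (h1ToC K (w i 0))) (S.phi hV hdeg (h1ToC K (w i 1)))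
        (S.phi hV hdeg (h1ToC K (w i 2))) (S.phi hV hdeg (h1ToC K (w i 3))) := by
  intro c hc
  obtain ⟨n, q, r, hr, rfl⟩ := hrat4 c hc
  choose w hw using fun i j => S.exists_phi_h1ToC_eq hV hdeg (hr i j)
  refine ⟨n, q, w, Finset.sum_congr rfl fun i _ => ?_⟩
  rw [hw i 0, hw i 1, hw i 2, hw i 3]

/-- THE IDENTIFICATION OF `T6A1Dict` FROM A RATIONAL STRUCTURE: `φ₁ := RatStructure.phi`, Lange's
`e : ⋀⁴ V1 ≃ V4` on `exteriorPower.ιMulti` (Prop. 1.1.20), and the degree-4 rationality clause. -/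
noncomputable def identOfRat (S : RatStructure act) (hV : Module.finrank ℂ V1 = 24)
    (hdeg : Module.finrank ℚ K = 6) (e : ⋀[ℂ]^4 V1 ≃ₗ[ℂ] V4)
    (he : ∀ v : Fin 4 → V1, e (exteriorPower.ιMulti ℂ 4 v) = cup4 (v 0) (v 1) (v 2) (v 3))
    (hrat4 : ∀ c : V4, ratl4 c → ∃ (n : ℕ) (q : Fin n → ℚ) (r : Fin n → Fin 4 → V1),
      (∀ i j, r i j ∈ S.R) ∧ c = ∑ i, (q i : ℂ) • cup4 (r i 0) (r i 1) (r i 2) (r i 3)) :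
    H1Ident K V1 V4 act cup4 ratl4 :=
  ofLange (S.phi hV hdeg) (S.phi_act hV hdeg) e he (hrat_of S hV hdeg hrat4)

/-- The transport of Theorem A's conclusion, assembled from a rational structure: `WeilClassesAlgebraic D`
gives «every rational split Weil class of the host carrier is in `alg`». -/
theorem splitWeilAlg_of_rat [IsGalois ℚ K] (S : RatStructure act) (hV : Module.finrank ℂ V1 = 24)
    {F : FaceSetting K} (e : ⋀[ℂ]^4 V1 ≃ₗ[ℂ] V4)
    (he : ∀ v : Fin 4 → V1, e (exteriorPower.ιMulti ℂ 4 v) = cup4 (v 0) (v 1) (v 2) (v 3))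
    (hrat4 : ∀ c : V4, ratl4 c → ∃ (n : ℕ) (q : Fin n → ℚ) (r : Fin n → Fin 4 → V1),
      (∀ i j, r i j ∈ S.R) ∧ c = ∑ i, (q i : ℂ) • cup4 (r i 0) (r i 1) (r i 2) (r i 3))
    (D : TransferShadow F) (alg : Submodule ℂ V4)
    (halg : ∀ y ∈ D.Alg 2, (identOfRat S hV F.deg6 e he hrat4).φ₄ (extC K y) ∈ alg)
    (hW : WeilClassesAlgebraic D) : SplitWeilAlg act cup4 ratl4 alg :=
  (identOfRat S hV F.deg6 e he hrat4).splitWeilAlg_of_weilClassesAlgebraic D alg halg hW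

end ident

end Summit.Ventures.HodgeRepro2.T6.A1DictRat
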